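import Mathlib.Algebra.Homology.BifunctorShift
import Mathlib.Algebra.Homology.HomotopyCategory.ShortExact
import HarnessLib

/-!
# The action of a bifunctor on cochain complexes commutes with mapping cones (first variable)

Pure homological algebra (Mathlib level).  For a bifunctor `F : C₁ ⥤ C₂ ⥤ D`, additive in the first variable, a
fixed cochain complex `K₂` and a morphism `φ : K₁ ⟶ L₁` of cochain complexes in `C₁`, the total complex functor
`Φ := K ↦ mapBifunctor K K₂ F` (Mathlib `Functor.map₂CochainComplex`, flipped) satisfies

  `Φ (mappingCone φ) ≅ mappingCone (Φ φ)`          (`mapBifunctorMappingConeIso`)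

with NO signs (the first-variable sign of Mathlib's total complex is `ε₁ = 1`), compatibly with `inr`
(`mapBifunctorMap_inr_comp_hom`), with the third morphisms of the standard triangles (`map_triangle_mor₃`, through the
sign-free `mapBifunctorShift₁Iso`) and with `descShortComplex` (`hom_comp_descShortComplex`).  This is the analogue,
for `Φ`, of Mathlib's `CochainComplex.mappingCone.mapHomologicalComplexIso` / `map_inr` / `map_δ` /
`mapHomologicalComplexIso_hom_descShortComplex` for `G.mapHomologicalComplex`, and is the input of the compatibility
of the descended functor of `Φ` with the connecting morphisms `DerivedCategory.triangleOfSESδ` (sequel file).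

HONEST FRAMING (cell pub-hsemireg, seat gs-g4): generic plumbing for the internal-Hom-complex functor `𝓗om•(K•, –)`
(`HomComplex.homFunctor`, which is such a `Φ` with the complex argument in the FIRST variable); NOT a door, NOT a
named fact; nothing here says HC, HC_CM or HC_AV is proved.

## References
* Mathlib: `Algebra.Homology.Bifunctor`, `BifunctorShift`, `HomotopyCategory.MappingCone`, `HomotopyCategory.ShortExact`.
* The Stacks project, Tag 0A5X-style sign conventions for total complexes / Hom complexes (folklore).
-/

noncomputable section

set_option backward.isDefEq.respectTransparency false

open CategoryTheory CategoryTheory.Category CategoryTheory.Limits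

namespace Summit.Ventures.HSemireg

namespace BifunctorCone

section Generic

variable {C₁ C₂ D : Type*} [Category C₁] [Category C₂] [Category D] (F : C₁ ⥤ C₂ ⥤ D)

/-- `F(f).app ≫ F(g).app = F(f ≫ g).app`. [folklore] -/
@[reassoc]
lemma map_app_comp {X Y Z : C₁} (f : X ⟶ Y) (g : Y ⟶ Z) (W : C₂) :
    (F.map f).app W ≫ (F.map g).app W = (F.map (f ≫ g)).app W := by
  rw [F.map_comp, NatTrans.comp_app]

/-- `F` additive in the first variable, on components. [folklore] -/
lemma map_add_app [Preadditive C₁] [Preadditive D] [F.Additive] {X Y : C₁} (f g : X ⟶ Y) (Z : C₂) :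
    (F.map (f + g)).app Z = (F.map f).app Z + (F.map g).app Z := by
  rw [F.map_add, NatTrans.app_add]

end Generic

section Main

variable {C₁ C₂ D : Type*} [Category C₁] [Category C₂] [Category D]
  [Preadditive C₁] [HasZeroMorphisms C₂] [Preadditive D]
  (F : C₁ ⥤ C₂ ⥤ D) [F.Additive] [∀ X₁ : C₁, (F.obj X₁).PreservesZeroMorphisms]
  [∀ (K₁ : CochainComplex C₁ ℤ) (K₂ : CochainComplex C₂ ℤ), CochainComplex.HasMapBifunctor K₁ K₂ F]
  [HasBinaryBiproducts C₁] [HasBinaryBiproducts D]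
  {K₁ L₁ : CochainComplex C₁ ℤ} (φ : K₁ ⟶ L₁) (K₂ : CochainComplex C₂ ℤ)

open CochainComplex CochainComplex.mappingCone

/-- `Φ φ = mapBifunctorMap φ (𝟙 K₂)`, the morphism of total complexes induced by `φ` in the first variable. [folklore] -/
abbrev φ' : mapBifunctor K₁ K₂ F ⟶ mapBifunctor L₁ K₂ F := HomologicalComplex.mapBifunctorMap φ (𝟙 K₂) F (.up ℤ)

/-- The summand map of `Φ(cone φ)ⁿ ⟶ cone(Φ φ)ⁿ` on `F(cone φ)ᵖ(K₂)^q`, `p + q = n`, written with a free successor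
index `p'` of `p` and `m` of `n`: `F(fst) ≫ ι ≫ inl + F(snd) ≫ ι ≫ inr`. [folklore] -/
def homSummand (p q n : ℤ) (hpq : p + q = n) (p' m : ℤ) (hp' : p + 1 = p') (hm : n + 1 = m) :
    (F.obj ((mappingCone φ).X p)).obj (K₂.X q) ⟶ (mappingCone (φ' F φ K₂)).X n :=
  (F.map ((fst φ).1.v p p' hp')).app (K₂.X q) ≫ ιMapBifunctor K₁ K₂ F p' q m (by omega) ≫
      (inl (φ' F φ K₂)).v m n (by omega) +
    (F.map ((snd φ).v p p (add_zero p))).app (K₂.X q) ≫ ιMapBifunctor L₁ K₂ F p q n hpq ≫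
      (inr (φ' F φ K₂)).f n

/-- Degree-`n` component of `Φ(cone φ) ≅ cone(Φ φ)` (forward). [folklore] -/
def homX (n : ℤ) : (mapBifunctor (mappingCone φ) K₂ F).X n ⟶ (mappingCone (φ' F φ K₂)).X n :=
  HomologicalComplex.mapBifunctorDesc fun p q (hpq : p + q = n) => homSummand F φ K₂ p q n hpq (p + 1) (n + 1) rfl rfl

/-- Summands of `homX`. [folklore] -/
@[reassoc]
lemma ι_homX (p q n : ℤ) (hpq : p + q = n) (p' m : ℤ) (hp' : p + 1 = p') (hm : n + 1 = m) :
    ιMapBifunctor (mappingCone φ) K₂ F p q n hpq ≫ homX F φ K₂ n = homSummand F φ K₂ p q n hpq p' m hp' hm := by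
  subst hp' hm
  simp [homX]

/-- Degree-`n` component of `Φ(cone φ) ≅ cone(Φ φ)` (backward): `fst ≫ [F(inl) ≫ ι] + snd ≫ [F(inr) ≫ ι]`. [folklore] -/
def invX (n m : ℤ) (hm : n + 1 = m) : (mappingCone (φ' F φ K₂)).X n ⟶ (mapBifunctor (mappingCone φ) K₂ F).X n :=
  (fst (φ' F φ K₂)).1.v n m hm ≫
      HomologicalComplex.mapBifunctorDesc (fun p' q (h : p' + q = m) =>
        (F.map ((inl φ).v p' (p' - 1) (by omega))).app (K₂.X q) ≫
          ιMapBifunctor (mappingCone φ) K₂ F (p' - 1) q n (by omega)) +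
    (snd (φ' F φ K₂)).v n n (add_zero n) ≫
      HomologicalComplex.mapBifunctorDesc (fun p q (h : p + q = n) =>
        (F.map ((inr φ).f p)).app (K₂.X q) ≫ ιMapBifunctor (mappingCone φ) K₂ F p q n h)

/-- `invX` on the `inl`-summands. [folklore] -/
@[reassoc]
lemma inl_invX (n m : ℤ) (hm : n + 1 = m) (p' q : ℤ) (h : p' + q = m) (p : ℤ) (hp : p + 1 = p') :
    ιMapBifunctor K₁ K₂ F p' q m h ≫ (inl (φ' F φ K₂)).v m n (by omega) ≫ invX F φ K₂ n m hm =
      (F.map ((inl φ).v p' p (by omega))).app (K₂.X q) ≫ ιMapBifunctor (mappingCone φ) K₂ F p q n (by omega) := by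
  obtain rfl : p = p' - 1 := by omega
  simp [invX]

/-- `invX` on the `inr`-summands. [folklore] -/
@[reassoc]
lemma inr_invX (n m : ℤ) (hm : n + 1 = m) (p q : ℤ) (h : p + q = n) :
    ιMapBifunctor L₁ K₂ F p q n h ≫ (inr (φ' F φ K₂)).f n ≫ invX F φ K₂ n m hm =
      (F.map ((inr φ).f p)).app (K₂.X q) ≫ ιMapBifunctor (mappingCone φ) K₂ F p q n h := by
  simp [invX]

/-- **Degree-`n` isomorphism `Φ(cone φ)ⁿ ≅ cone(Φ φ)ⁿ`** (the cone identities `fst ≫ inl + snd ≫ inr = 𝟙`, etc., and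
additivity of `F` in the first variable). [folklore] -/
def XIso (n m : ℤ) (hm : n + 1 = m) : (mapBifunctor (mappingCone φ) K₂ F).X n ≅ (mappingCone (φ' F φ K₂)).X n where
  hom := homX F φ K₂ n
  inv := invX F φ K₂ n m hm
  hom_inv_id := by
    ext p q hpq
    have hpq' : p + q = n := hpq
    rw [comp_id, ι_homX_assoc F φ K₂ p q n hpq (p + 1) m rfl hm, homSummand, Preadditive.add_comp, assoc, assoc,
      assoc, assoc, inl_invX F φ K₂ n m hm (p + 1) q (by omega) p rfl, inr_invX F φ K₂ n m hm p q hpq,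
      map_app_comp_assoc, map_app_comp_assoc, ← Preadditive.add_comp, ← map_add_app, id_X, F.map_id,
      NatTrans.id_app, id_comp]
  inv_hom_id := by
    rw [ext_from_iff _ m n hm]
    constructor
    · rw [comp_id]
      ext p' q h
      have h' : p' + q = m := h
      rw [inl_invX_assoc F φ K₂ n m hm p' q h (p' - 1) (by omega),
        ι_homX F φ K₂ (p' - 1) q n (by omega) p' m (by omega) hm, homSummand, Preadditive.comp_add,
        map_app_comp_assoc, map_app_comp_assoc, inl_v_fst_v, inl_v_snd_v, F.map_id, NatTrans.id_app, id_comp,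
        F.map_zero, NatTrans.app_zero, zero_comp, add_zero]
    · rw [comp_id]
      ext p q h
      rw [inr_invX_assoc F φ K₂ n m hm p q h, ι_homX F φ K₂ p q n h (p + 1) m rfl hm, homSummand,
        Preadditive.comp_add, map_app_comp_assoc, map_app_comp_assoc, inr_f_fst_v, inr_f_snd_v, F.map_id,
        NatTrans.id_app, id_comp, F.map_zero, NatTrans.app_zero, zero_comp, zero_add]

omit [HasBinaryBiproducts C₁] [HasBinaryBiproducts D] in
/-- The differential of the total complex on a summand (cochain indexing; first-variable sign `ε₁ = 1`, second
`ε₂ = (-1)ᵖ`), with free successor indices. [folklore] -/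
@[reassoc]
lemma ι_mapBifunctor_d (K : CochainComplex C₁ ℤ) (p q n : ℤ) (hpq : p + q = n) (p' q' m : ℤ) (hp' : p + 1 = p')
    (hq' : q + 1 = q') (hm : n + 1 = m) :
    ιMapBifunctor K K₂ F p q n hpq ≫ (mapBifunctor K K₂ F).d n m =
      (F.map (K.d p p')).app (K₂.X q) ≫ ιMapBifunctor K K₂ F p' q m (by omega) +
        p.negOnePow • ((F.obj (K.X p)).map (K₂.d q q') ≫ ιMapBifunctor K K₂ F p q' m (by omega)) := by
  rw [HomologicalComplex.mapBifunctor.d_eq, Preadditive.comp_add, HomologicalComplex.mapBifunctor.ι_D₁,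
    HomologicalComplex.mapBifunctor.ι_D₂,
    HomologicalComplex.mapBifunctor.d₁_eq K K₂ F _ (show (ComplexShape.up ℤ).Rel p p' from hp') q m
      (by dsimp; omega),
    HomologicalComplex.mapBifunctor.d₂_eq K K₂ F _ p (show (ComplexShape.up ℤ).Rel q q' from hq') m
      (by dsimp; omega)]
  simp

/-- `homX` commutes with the differentials. [folklore] -/
lemma homX_comm (n m : ℤ) (hm : n + 1 = m) :
    homX F φ K₂ n ≫ (mappingCone (φ' F φ K₂)).d n m = (mapBifunctor (mappingCone φ) K₂ F).d n m ≫ homX F φ K₂ m := by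
  ext p q hpq
  have hpq' : p + q = n := hpq
  rw [ι_homX_assoc F φ K₂ p q n hpq (p + 1) m rfl hm,
    ι_mapBifunctor_d_assoc F K₂ (mappingCone φ) p q n hpq (p + 1) (q + 1) m rfl rfl hm,
    Preadditive.add_comp, Linear.units_smul_comp, assoc, assoc,
    ι_homX F φ K₂ (p + 1) q m (by omega) (p + 2) (m + 1) (by omega) rfl,
    ι_homX F φ K₂ p (q + 1) m (by omega) (p + 1) (m + 1) rfl rfl, homSummand, homSummand, homSummand,
    mappingCone.ext_to_iff _ m (m + 1) rfl]
  constructor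
  · simp only [Preadditive.add_comp, Preadditive.comp_add, Linear.units_smul_comp, assoc,
      inl_v_fst_v, comp_id, inr_f_fst_v, comp_zero, add_zero,
      inl_v_d (φ' F φ K₂) m n (m + 1) (by omega) (by omega), inr_f_d, Preadditive.comp_sub, Preadditive.sub_comp,
      ι_mapBifunctor_d_assoc F K₂ K₁ (p + 1) q m (by omega)
        (p + 2) (q + 1) (m + 1) (by omega) rfl rfl, map_app_comp_assoc, d_fst_v φ p (p + 1) (p + 2) rfl (by omega),
      Functor.map_neg, NatTrans.app_neg, Preadditive.neg_comp, NatTrans.naturality_assoc, Int.negOnePow_succ,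
      Units.neg_smul, Preadditive.comp_neg, Linear.comp_units_smul]
    abel
  · simp only [Preadditive.add_comp, Preadditive.comp_add, Linear.units_smul_comp, Linear.comp_units_smul, assoc,
      inl_v_snd_v, comp_id, inr_f_snd_v, comp_zero, zero_add,
      inl_v_d (φ' F φ K₂) m n (m + 1) (by omega) (by omega), inr_f_d, Preadditive.comp_sub, Preadditive.sub_comp,
      sub_zero, HomologicalComplex.ι_mapBifunctorMap_assoc,
      ι_mapBifunctor_d_assoc F K₂ L₁ p q n hpq (p + 1) (q + 1) m rfl rfl hm, map_app_comp_assoc,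
      d_snd_v φ p (p + 1) rfl, Functor.map_add, NatTrans.app_add, Preadditive.add_comp, NatTrans.naturality_assoc,
      HomologicalComplex.id_f, CategoryTheory.Functor.map_id, id_comp]
    abel

omit [HasBinaryBiproducts C₁] [HasBinaryBiproducts D] in
/-- `Φ = mapBifunctor (–) K₂ F` is an additive functor when `F` is additive in the first variable. [folklore] -/
instance map₂CochainComplex_flip_obj_additive : (F.map₂CochainComplex.flip.obj K₂).Additive where
  map_add {K L f g} := by
    ext n
    change (HomologicalComplex.mapBifunctorMap (f + g) (𝟙 K₂) F (.up ℤ)).f n =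
      (HomologicalComplex.mapBifunctorMap f (𝟙 K₂) F (.up ℤ) + HomologicalComplex.mapBifunctorMap g (𝟙 K₂) F (.up ℤ)).f n
    refine HomologicalComplex.mapBifunctor.hom_ext (fun p q hpq => ?_)
    rw [HomologicalComplex.add_f_apply, Preadditive.comp_add, HomologicalComplex.ι_mapBifunctorMap,
      HomologicalComplex.ι_mapBifunctorMap, HomologicalComplex.ι_mapBifunctorMap, HomologicalComplex.add_f_apply,
      map_add_app, Preadditive.add_comp]

/-- **`Φ(mappingCone φ) ≅ mappingCone(Φ φ)`** for `Φ = mapBifunctor (–) K₂ F` — the first-variable analogue of Mathlib's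
`mappingCone.mapHomologicalComplexIso`; sign-free. [folklore] -/
def mapBifunctorMappingConeIso : mapBifunctor (mappingCone φ) K₂ F ≅ mappingCone (φ' F φ K₂) :=
  HomologicalComplex.Hom.isoOfComponents (fun n => XIso F φ K₂ n (n + 1) rfl) fun n m hnm => by
    have hm : n + 1 = m := hnm
    exact homX_comm F φ K₂ n m hm

/-- Components of `mapBifunctorMappingConeIso`. [folklore] -/
lemma mapBifunctorMappingConeIso_hom_f (n : ℤ) : (mapBifunctorMappingConeIso F φ K₂).hom.f n = homX F φ K₂ n := rfl

/-- **Compatibility with `inr`**: `Φ(inr φ) ≫ iso = inr (Φ φ)`. [folklore] -/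
@[reassoc]
theorem mapBifunctorMap_inr_comp_hom :
    HomologicalComplex.mapBifunctorMap (inr φ) (𝟙 K₂) F (.up ℤ) ≫ (mapBifunctorMappingConeIso F φ K₂).hom =
      inr (φ' F φ K₂) := by
  ext n p q hpq
  have hpq' : p + q = n := hpq
  rw [HomologicalComplex.comp_f, mapBifunctorMappingConeIso_hom_f, HomologicalComplex.ι_mapBifunctorMap_assoc,
    HomologicalComplex.id_f, CategoryTheory.Functor.map_id, id_comp]
  erw [ι_homX F φ K₂ p q n hpq (p + 1) (n + 1) rfl rfl]
  rw [homSummand, Preadditive.comp_add, map_app_comp_assoc, map_app_comp_assoc, inr_f_fst_v, inr_f_snd_v,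
    F.map_zero, NatTrans.app_zero, zero_comp, zero_add, F.map_id, NatTrans.id_app, id_comp]

omit [∀ X₁ : C₁, (F.obj X₁).PreservesZeroMorphisms]
  [∀ (K₁ : CochainComplex C₁ ℤ) (K₂ : CochainComplex C₂ ℤ), CochainComplex.HasMapBifunctor K₁ K₂ F]
  [HasBinaryBiproducts D] in
/-- The components of the third morphism of the standard triangle: `δ_φ = -fst` (up to the identification
`(K₁⟦1⟧)ᵖ = K₁ᵖ⁺¹`). [folklore] -/
lemma triangle_mor₃_f_eq (p p' : ℤ) (hp' : p + 1 = p') :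
    HomologicalComplex.Hom.f (A := mappingCone φ) (B := K₁⟦(1 : ℤ)⟧) (triangle φ).mor₃ p =
      -((fst φ).1.v p p' hp' ≫ (K₁.shiftFunctorObjXIso 1 p p' (by omega)).inv) := by
  have h1 := inl_v_triangle_mor₃_f φ p' p (by omega)
  have h2 := inr_f_triangle_mor₃_f φ p
  calc HomologicalComplex.Hom.f (A := mappingCone φ) (B := K₁⟦(1 : ℤ)⟧) (triangle φ).mor₃ p
      = ((fst φ).1.v p p' hp' ≫ (inl φ).v p' p (by omega) + (snd φ).v p p (add_zero p) ≫ (inr φ).f p) ≫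
          HomologicalComplex.Hom.f (A := mappingCone φ) (B := K₁⟦(1 : ℤ)⟧) (triangle φ).mor₃ p := by
        rw [id_X φ p p' hp', id_comp]
    _ = (fst φ).1.v p p' hp' ≫ ((inl φ).v p' p (by omega) ≫
            HomologicalComplex.Hom.f (A := mappingCone φ) (B := K₁⟦(1 : ℤ)⟧) (triangle φ).mor₃ p) +
          (snd φ).v p p (add_zero p) ≫ ((inr φ).f p ≫
            HomologicalComplex.Hom.f (A := mappingCone φ) (B := K₁⟦(1 : ℤ)⟧) (triangle φ).mor₃ p) := by
        rw [Preadditive.add_comp, assoc, assoc]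
    _ = -((fst φ).1.v p p' hp' ≫ (K₁.shiftFunctorObjXIso 1 p p' (by omega)).inv) := by
        erw [h1, h2]
        simp only [comp_zero, add_zero, Preadditive.comp_neg]

/-- **Compatibility with the third morphisms of the standard triangles** (first-variable analogue of Mathlib's
`mappingCone.map_δ`): `Φ(δ_φ) ≫ (shift comparison) = iso ≫ δ_{Φ φ}`, the shift comparison being the sign-free
`mapBifunctorShift₁Iso`. [folklore] -/
@[reassoc]
theorem map_triangle_mor₃ :
    HomologicalComplex.mapBifunctorMap (K₁ := mappingCone φ) (L₁ := K₁⟦(1 : ℤ)⟧) (triangle φ).mor₃ (𝟙 K₂) F (.up ℤ) ≫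
        (mapBifunctorShift₁Iso K₁ K₂ F 1).hom =
      (mapBifunctorMappingConeIso F φ K₂).hom ≫ (triangle (φ' F φ K₂)).mor₃ := by
  ext n p q hpq
  have hpq' : p + q = n := hpq
  simp only [HomologicalComplex.comp_f, mapBifunctorMappingConeIso_hom_f,
    HomologicalComplex.ι_mapBifunctorMap_assoc, HomologicalComplex.id_f, CategoryTheory.Functor.map_id, id_comp]
  erw [ι_homX_assoc F φ K₂ p q n hpq (p + 1) (n + 1) rfl rfl,
    ι_mapBifunctorShift₁Iso_hom_f K₁ K₂ F 1 p q n hpq' (p + 1) (n + 1) rfl rfl]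
  erw [map_app_comp_assoc, triangle_mor₃_f_eq φ p (p + 1) rfl]
  rw [homSummand, Preadditive.add_comp, assoc, assoc, assoc, assoc]
  erw [inr_f_triangle_mor₃_f, inl_v_triangle_mor₃_f]
  simp only [Preadditive.neg_comp, assoc, Iso.inv_hom_id, Functor.map_neg, NatTrans.app_neg, Preadditive.comp_neg,
    comp_zero, add_zero]
  erw [comp_id]

/-- **Compatibility with `desc`** (zero first component): `iso ≫ desc (Φ φ) 0 (Φ g) = Φ (desc φ 0 g)`; the case of
`descShortComplex` of a short complex. [folklore] -/
@[reassoc]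
theorem hom_comp_desc_zero {M : CochainComplex C₁ ℤ} (g : L₁ ⟶ M) (hg : φ ≫ g = 0)
    (h' : HomComplex.δ (-1) 0 (0 : HomComplex.Cochain (mapBifunctor K₁ K₂ F) (mapBifunctor M K₂ F) (-1)) =
      HomComplex.Cochain.ofHom (φ' F φ K₂ ≫ HomologicalComplex.mapBifunctorMap g (𝟙 K₂) F (.up ℤ))) :
    (mapBifunctorMappingConeIso F φ K₂).hom ≫ desc (φ' F φ K₂) 0 (HomologicalComplex.mapBifunctorMap g (𝟙 K₂) F (.up ℤ)) h' =
      HomologicalComplex.mapBifunctorMap (desc φ 0 g (by simp [hg])) (𝟙 K₂) F (.up ℤ) := by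
  ext n p q hpq
  have hpq' : p + q = n := hpq
  rw [HomologicalComplex.comp_f, mapBifunctorMappingConeIso_hom_f, HomologicalComplex.ι_mapBifunctorMap,
    HomologicalComplex.id_f, CategoryTheory.Functor.map_id, id_comp, desc_f _ _ _ _ p (p + 1) rfl]
  erw [ι_homX_assoc F φ K₂ p q n hpq (p + 1) (n + 1) rfl rfl]
  rw [homSummand, Preadditive.add_comp, assoc, assoc, assoc, assoc, inl_v_desc_f, inr_f_desc_f]
  simp only [HomComplex.Cochain.zero_v, comp_zero, zero_add, HomologicalComplex.ι_mapBifunctorMap,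
    HomologicalComplex.id_f, CategoryTheory.Functor.map_id, id_comp, map_app_comp_assoc]

end Main

end BifunctorCone

end Summit.Ventures.HSemireg
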